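import Mathlib
import Summits.NavierStokesRegularity.NavierStokesRegularity.Theorems.TypeIQuarterGateScarEnvelopeTypeISatelliteTowerGalleryExactMin

/-!
# Birkhoff recurrence for the root-zoom semiflow (abstract step) and the gallery distance

Two NS-free tools for the crux idea `Cruxes/ScarEnvelopeTypeI/Ideas/zoom-recurrence.md`
(ns-idea-17 g0, rung (L11) `ExistsDoublyMinimal`) on the crux `TypeIQuarterGate.ScarEnvelopeTypeI`
(item 23843):

* `exists_recurrent_point` — **Birkhoff's recurrence theorem** for a continuous action of the
  multiplicative semigroup `(0,1]` on a nonempty compact space: some point lies in the closure of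
  every tail `{T l x : 0 < l ≤ 1/(k+1)}` of its own orbit (Zorn on nonempty closed invariant sets —
  Cantor's intersection theorem for chains — then the ω-limit set of any point of a minimal set is a
  nonempty closed invariant subset, hence the whole minimal set). [folklore: G. D. Birkhoff 1927;
  Gottschalk–Hedlund 1955, Thm 2.22 / 4.05; Furstenberg 1981 Thm 1.4]
* `galleryDist` — the `L³_loc` gallery distance `sup_n min(2^{-n}, ‖W − W'‖_{L³(Q_{n+1}(0))})` on
  fields of the closed past, a pseudometric on `L³_loc` fields whose convergence is exactly
  `L³(Q_R(0))`-convergence for every `R > 0` (`tendsto_galleryDist_iff`).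

HONEST FRAMING: abstract tooling; nothing open is proved — 23843, `∀ M, ¬ OneScarLeaf M`,
`∀ M, ¬ InfiniteDescent M`, the route and Navier–Stokes regularity are OPEN.  LEAD-lineage prover
ns-sz-p1 g6; `--supports stmt-NavierStokesRegularity-23843 --as helper`.
-/

noncomputable section

-- the summit-side namespace repeats a component by design (single-conjunct summit, D-0017)
set_option linter.dupNamespace false

open MeasureTheory Set Metric Filter Topology
open scoped ENNReal

namespace Summit.NavierStokesRegularity.NavierStokesRegularity.Cruxes.ScarEnvelopeTypeI.ZoomDictionary

/-! ### Birkhoff recurrence for a continuous `(0,1]`-semigroup action on a compact space -/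

section Birkhoff

variable {X : Type*} [TopologicalSpace X]

/-- **Birkhoff recurrence (multiplicative semigroup `(0,1]`).**  Let `T l : X → X` (`0 < l ≤ 1`)
be continuous maps of a nonempty compact space with `T l ∘ T μ = T (l μ)`.  Then some point `x`
lies in the closure of every orbit tail `{T l x : 0 < l ≤ 1/(k+1)}` — i.e. `x ∈ ω(x)`. -/
theorem exists_recurrent_point [CompactSpace X] [Nonempty X] (T : ℝ → X → X)
    (hcont : ∀ l : ℝ, 0 < l → l ≤ 1 → Continuous (T l))
    (hmul : ∀ l μ : ℝ, 0 < l → l ≤ 1 → 0 < μ → μ ≤ 1 → ∀ x, T l (T μ x) = T (l * μ) x) :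
    ∃ x : X, ∀ k : ℕ, x ∈ closure {y : X | ∃ l : ℝ, 0 < l ∧ l ≤ 1 / ((k : ℝ) + 1) ∧ y = T l x} := by
  classical
  -- ## the family of nonempty closed invariant sets; a minimal member by Zorn
  set S : Set (Set X) :=
    {A | A.Nonempty ∧ IsClosed A ∧ ∀ l : ℝ, 0 < l → l ≤ 1 → MapsTo (T l) A A} with hSdef
  have huniv : (univ : Set X) ∈ S := ⟨univ_nonempty, isClosed_univ, fun l _ _ => mapsTo_univ _ _⟩
  have hchain : ∀ c ⊆ S, IsChain (· ⊆ ·) c → c.Nonempty → ∃ lb ∈ S, ∀ s ∈ c, lb ⊆ s := by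
    intro c hcS hc hcne
    refine ⟨⋂₀ c, ⟨?_, ?_, ?_⟩, fun s hs => sInter_subset_of_mem hs⟩
    · haveI : Nonempty c := hcne.to_subtype
      refine IsCompact.nonempty_sInter_of_directed_nonempty_isCompact_isClosed ?_
        (fun A hA => (hcS hA).1) (fun A hA => (hcS hA).2.1.isCompact) (fun A hA => (hcS hA).2.1)
      intro A hA B hB
      by_cases hAB : A = B
      · subst hAB
        exact ⟨A, hA, Subset.rfl, Subset.rfl⟩
      · rcases hc hA hB hAB with h | h
        · exact ⟨A, hA, Subset.rfl, h⟩
        · exact ⟨B, hB, h, Subset.rfl⟩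
    · exact isClosed_sInter fun A hA => (hcS hA).2.1
    · intro l hl hl1 y hy
      exact mem_sInter.2 fun A hA => (hcS hA).2.2 l hl hl1 (mem_sInter.1 hy A hA)
  obtain ⟨M, -, hMmin⟩ := zorn_superset_nonempty S hchain univ huniv
  obtain ⟨⟨x, hxM⟩, hMcl, hMinv⟩ := hMmin.prop
  refine ⟨x, ?_⟩
  -- ## the ω-limit set of `x`: nonempty, closed, invariant, inside `M` — hence all of `M`
  set A : ℕ → Set X := fun k => {y : X | ∃ l : ℝ, 0 < l ∧ l ≤ 1 / ((k : ℝ) + 1) ∧ y = T l x}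
    with hAdef
  have hkpos : ∀ k : ℕ, (0 : ℝ) < 1 / ((k : ℝ) + 1) := fun k => by positivity
  have hkle : ∀ k : ℕ, 1 / ((k : ℝ) + 1) ≤ 1 := fun k => by
    rw [div_le_one (by positivity)]; linarith [(Nat.cast_nonneg k : (0 : ℝ) ≤ k)]
  have hAM : ∀ k, A k ⊆ M := by
    rintro k y ⟨l, hl, hlk, rfl⟩
    exact hMinv l hl (hlk.trans (hkle k)) hxM
  have hAne : ∀ k, (closure (A k)).Nonempty := fun k =>
    ⟨T (1 / ((k : ℝ) + 1)) x, subset_closure ⟨_, hkpos k, le_rfl, rfl⟩⟩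
  have hAanti : ∀ k k' : ℕ, k ≤ k' → A k' ⊆ A k := by
    rintro k k' hkk' y ⟨l, hl, hlk, rfl⟩
    refine ⟨l, hl, hlk.trans ?_, rfl⟩
    exact one_div_le_one_div_of_le (by positivity) (by exact_mod_cast Nat.add_le_add_right hkk' 1)
  set Ω : Set X := ⋂ k, closure (A k) with hΩdef
  have hΩM : Ω ⊆ M := fun y hy =>
    hMcl.closure_subset_iff.2 (hAM 0) (mem_iInter.1 hy 0)
  have hΩne : Ω.Nonempty := by
    refine IsCompact.nonempty_iInter_of_directed_nonempty_isCompact_isClosed _ ?_ hAne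
      (fun k => isClosed_closure.isCompact) (fun k => isClosed_closure)
    intro i j
    exact ⟨max i j, closure_mono (hAanti i _ (le_max_left i j)),
      closure_mono (hAanti j _ (le_max_right i j))⟩
  have hΩcl : IsClosed Ω := isClosed_iInter fun k => isClosed_closure
  have hΩinv : ∀ μ : ℝ, 0 < μ → μ ≤ 1 → MapsTo (T μ) Ω Ω := by
    intro μ hμ hμ1 y hy
    refine mem_iInter.2 fun k => ?_
    have hyk : y ∈ closure (A k) := mem_iInter.1 hy k
    have h1 : T μ '' closure (A k) ⊆ closure (T μ '' A k) :=
      image_closure_subset_closure_image (hcont μ hμ hμ1)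
    have h2 : T μ '' A k ⊆ A k := by
      rintro _ ⟨y', ⟨l, hl, hlk, rfl⟩, rfl⟩
      refine ⟨μ * l, mul_pos hμ hl, ?_, hmul μ l hμ hμ1 hl (hlk.trans (hkle k)) x⟩
      calc μ * l ≤ 1 * l := by gcongr
        _ = l := one_mul l
        _ ≤ _ := hlk
    exact closure_mono h2 (h1 ⟨y, hyk, rfl⟩)
  have hΩS : Ω ∈ S := ⟨hΩne, hΩcl, hΩinv⟩
  have hMΩ : M ⊆ Ω := hMmin.2 hΩS hΩM
  exact fun k => mem_iInter.1 (hMΩ hxM) k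

end Birkhoff

/-! ### The gallery distance on `L³_loc` fields of the closed past -/

section GalleryDist

open Literature.Analysis.FluidPDE
variable {U V W : ℝ → (EuclideanSpace ℝ (Fin 3)) → (EuclideanSpace ℝ (Fin 3))}

/-- The `L³` distance of two fields on the backward cylinder `Q_{n+1}(0)`, as a real number
(`⊤ ↦ 0`; finite on `L³_loc` fields). -/
def cylDist (n : ℕ) (W W' : ℝ → (EuclideanSpace ℝ (Fin 3)) → (EuclideanSpace ℝ (Fin 3))) : ℝ :=
  (eLpNorm (Function.uncurry W - Function.uncurry W') 3
    (volume.restrict (parabolicCylinder ((n : ℝ) + 1) (0 : ℝ × (EuclideanSpace ℝ (Fin 3)))))).toReal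

/-- **The gallery distance** `d(W, W') = sup_n min(2^{-n}, ‖W − W'‖_{L³(Q_{n+1}(0))})`. -/
def galleryDist (W W' : ℝ → (EuclideanSpace ℝ (Fin 3)) → (EuclideanSpace ℝ (Fin 3))) : ℝ :=
  ⨆ n : ℕ, min ((1 / 2 : ℝ) ^ n) (cylDist n W W')

/-- Cylinder distances are nonnegative. -/
theorem cylDist_nonneg (n : ℕ) (W W' : ℝ → (EuclideanSpace ℝ (Fin 3)) → (EuclideanSpace ℝ (Fin 3))) :
    0 ≤ cylDist n W W' := ENNReal.toReal_nonneg

/-- The cylinder distance of a field to itself vanishes. -/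
theorem cylDist_self (n : ℕ) (W : ℝ → (EuclideanSpace ℝ (Fin 3)) → (EuclideanSpace ℝ (Fin 3))) :
    cylDist n W W = 0 := by
  simp [cylDist]

/-- Cylinder distances are symmetric. -/
theorem cylDist_comm (n : ℕ) (W W' : ℝ → (EuclideanSpace ℝ (Fin 3)) → (EuclideanSpace ℝ (Fin 3))) :
    cylDist n W W' = cylDist n W' W := by
  rw [cylDist, cylDist, eLpNorm_sub_comm]

/-- Triangle inequality for the cylinder distances of `L³_loc` fields. -/
theorem cylDist_triangle (n : ℕ) (hU : L3loc U) (hV : L3loc V) (hW : L3loc W) :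
    cylDist n U W ≤ cylDist n U V + cylDist n V W := by
  have hn : (0 : ℝ) < (n : ℝ) + 1 := by positivity
  have hUV := (hU _ hn).sub (hV _ hn)
  have hVW := (hV _ hn).sub (hW _ hn)
  rw [cylDist, cylDist, cylDist, ← ENNReal.toReal_add hUV.2.ne hVW.2.ne]
  refine ENNReal.toReal_mono (ENNReal.add_ne_top.2 ⟨hUV.2.ne, hVW.2.ne⟩) ?_
  have e : Function.uncurry U - Function.uncurry W =
      (Function.uncurry U - Function.uncurry V) + (Function.uncurry V - Function.uncurry W) := by abel
  rw [e]
  exact eLpNorm_add_le hUV.1 hVW.1 (by norm_num)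

/-- The terms of the gallery distance are bounded by `1`. -/
theorem galleryDist_bddAbove (W W' : ℝ → (EuclideanSpace ℝ (Fin 3)) → (EuclideanSpace ℝ (Fin 3))) :
    BddAbove (Set.range fun n : ℕ => min ((1 / 2 : ℝ) ^ n) (cylDist n W W')) := by
  refine ⟨1, ?_⟩
  rintro _ ⟨n, rfl⟩
  exact (min_le_left _ _).trans (pow_le_one₀ (by norm_num) (by norm_num))

/-- Each truncated cylinder distance is dominated by the gallery distance. -/
theorem term_le_galleryDist (n : ℕ) (W W' : ℝ → (EuclideanSpace ℝ (Fin 3)) → (EuclideanSpace ℝ (Fin 3))) :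
    min ((1 / 2 : ℝ) ^ n) (cylDist n W W') ≤ galleryDist W W' :=
  le_ciSup (galleryDist_bddAbove W W') n

/-- A uniform bound on the truncated cylinder distances bounds the gallery distance. -/
theorem galleryDist_le {W W' : ℝ → (EuclideanSpace ℝ (Fin 3)) → (EuclideanSpace ℝ (Fin 3))} {ε : ℝ}
    (h : ∀ n : ℕ, min ((1 / 2 : ℝ) ^ n) (cylDist n W W') ≤ ε) : galleryDist W W' ≤ ε :=
  ciSup_le h

/-- The gallery distance is nonnegative. -/
theorem galleryDist_nonneg (W W' : ℝ → (EuclideanSpace ℝ (Fin 3)) → (EuclideanSpace ℝ (Fin 3))) :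
    0 ≤ galleryDist W W' :=
  (le_min (pow_nonneg (by norm_num) 0) (cylDist_nonneg 0 W W')).trans (term_le_galleryDist 0 W W')

/-- The gallery distance is at most `1`. -/
theorem galleryDist_le_one (W W' : ℝ → (EuclideanSpace ℝ (Fin 3)) → (EuclideanSpace ℝ (Fin 3))) :
    galleryDist W W' ≤ 1 :=
  galleryDist_le fun n => (min_le_left _ _).trans (pow_le_one₀ (by norm_num) (by norm_num))

/-- The gallery distance of a field to itself vanishes. -/
theorem galleryDist_self (W : ℝ → (EuclideanSpace ℝ (Fin 3)) → (EuclideanSpace ℝ (Fin 3))) :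
    galleryDist W W = 0 := by
  refine le_antisymm (galleryDist_le fun n => ?_) (galleryDist_nonneg W W)
  rw [cylDist_self]
  exact min_le_right _ _

/-- The gallery distance is symmetric. -/
theorem galleryDist_comm (W W' : ℝ → (EuclideanSpace ℝ (Fin 3)) → (EuclideanSpace ℝ (Fin 3))) :
    galleryDist W W' = galleryDist W' W := by
  unfold galleryDist
  congr 1
  funext n
  rw [cylDist_comm]

/-- Triangle inequality for the gallery distance of `L³_loc` fields. -/
theorem galleryDist_triangle (hU : L3loc U) (hV : L3loc V) (hW : L3loc W) :
    galleryDist U W ≤ galleryDist U V + galleryDist V W := by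
  refine galleryDist_le fun n => ?_
  have ht : (0 : ℝ) ≤ (1 / 2 : ℝ) ^ n := pow_nonneg (by norm_num) n
  have h1 : min ((1 / 2 : ℝ) ^ n) (cylDist n U W) ≤
      min ((1 / 2 : ℝ) ^ n) (cylDist n U V) + min ((1 / 2 : ℝ) ^ n) (cylDist n V W) := by
    have htri := cylDist_triangle n hU hV hW
    have ha := cylDist_nonneg n U V
    have hb := cylDist_nonneg n V W
    rcases le_total ((1 / 2 : ℝ) ^ n) (cylDist n U V) with h | h
    · rw [min_eq_left h]
      exact (min_le_left _ _).trans (le_add_of_nonneg_right (le_min ht hb))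
    · rw [min_eq_right h]
      rcases le_total ((1 / 2 : ℝ) ^ n) (cylDist n V W) with h' | h'
      · rw [min_eq_left h']
        exact (min_le_left _ _).trans (le_add_of_nonneg_left ha)
      · rw [min_eq_right h']
        exact (min_le_right _ _).trans htri
  exact h1.trans (add_le_add (term_le_galleryDist n U V) (term_le_galleryDist n V W))

/-- **`L³(Q_R(0))`-convergence for every `R > 0` ⇒ gallery distance `→ 0`.** -/
theorem tendsto_galleryDist_of_tendsto
    {Ws : ℕ → ℝ → (EuclideanSpace ℝ (Fin 3)) → (EuclideanSpace ℝ (Fin 3))}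
    (hconv : ∀ R : ℝ, 0 < R → Tendsto (fun j => eLpNorm
      (Function.uncurry (Ws j) - Function.uncurry W) 3
      (volume.restrict (parabolicCylinder R (0 : ℝ × (EuclideanSpace ℝ (Fin 3)))))) atTop (𝓝 0)) :
    Tendsto (fun j => galleryDist (Ws j) W) atTop (𝓝 0) := by
  rw [Metric.tendsto_atTop]
  intro ε hε
  have hε2 : (0 : ℝ) < ε / 2 := by linarith
  obtain ⟨N, hN⟩ := exists_pow_lt_of_lt_one hε2 (by norm_num : (1 / 2 : ℝ) < 1)
  -- each cylinder distance tends to `0`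
  have hsmall : ∀ n : ℕ, ∀ᶠ j in atTop, cylDist n (Ws j) W < ε / 2 := by
    intro n
    have hn : (0 : ℝ) < (n : ℝ) + 1 := by positivity
    have h : Tendsto (fun j => cylDist n (Ws j) W) atTop (𝓝 0) := by
      have h1 := (ENNReal.tendsto_toReal ENNReal.zero_ne_top).comp (hconv _ hn)
      rwa [ENNReal.toReal_zero] at h1
    exact h.eventually (Iio_mem_nhds hε2)
  have hall : ∀ᶠ j in atTop, ∀ n ∈ Finset.range N, cylDist n (Ws j) W < ε / 2 :=
    (Finset.range N).eventually_all.2 fun n _ => hsmall n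
  obtain ⟨J, hJ⟩ := eventually_atTop.1 hall
  refine ⟨J, fun j hj => ?_⟩
  rw [Real.dist_eq, sub_zero, abs_of_nonneg (galleryDist_nonneg _ _)]
  refine lt_of_le_of_lt (galleryDist_le (ε := ε / 2) fun n => ?_) (by linarith)
  by_cases hn : n < N
  · exact (min_le_right _ _).trans (hJ j hj n (Finset.mem_range.2 hn)).le
  · refine (min_le_left _ _).trans ?_
    exact ((pow_le_pow_of_le_one (by norm_num) (by norm_num) (not_lt.1 hn)).trans hN.le)

/-- **Gallery distance `→ 0` ⇒ `L³(Q_R(0))`-convergence for every `R > 0`** (for `L³_loc` fields). -/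
theorem tendsto_of_tendsto_galleryDist
    {Ws : ℕ → ℝ → (EuclideanSpace ℝ (Fin 3)) → (EuclideanSpace ℝ (Fin 3))}
    (hWs : ∀ j, L3loc (Ws j)) (hW : L3loc W)
    (hd : Tendsto (fun j => galleryDist (Ws j) W) atTop (𝓝 0)) {R : ℝ} (hR : 0 < R) :
    Tendsto (fun j => eLpNorm (Function.uncurry (Ws j) - Function.uncurry W) 3
      (volume.restrict (parabolicCylinder R (0 : ℝ × (EuclideanSpace ℝ (Fin 3)))))) atTop (𝓝 0) := by
  -- a cylinder `Q_{n+1}(0) ⊇ Q_R(0)`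
  obtain ⟨n, hn⟩ := exists_nat_ge R
  have hn1 : (0 : ℝ) < (n : ℝ) + 1 := by positivity
  have hsub : parabolicCylinder R (0 : ℝ × (EuclideanSpace ℝ (Fin 3))) ⊆
      parabolicCylinder ((n : ℝ) + 1) (0 : ℝ × (EuclideanSpace ℝ (Fin 3))) :=
    parabolicCylinder_mono hR.le (by linarith) _
  -- the `n`-th cylinder distance tends to `0`
  have hfin : ∀ j, eLpNorm (Function.uncurry (Ws j) - Function.uncurry W) 3
      (volume.restrict (parabolicCylinder ((n : ℝ) + 1) (0 : ℝ × (EuclideanSpace ℝ (Fin 3))))) ≠ ⊤ :=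
    fun j => (((hWs j) _ hn1).sub (hW _ hn1)).2.ne
  have hcyl : Tendsto (fun j => cylDist n (Ws j) W) atTop (𝓝 0) := by
    have hev : ∀ᶠ j in atTop, galleryDist (Ws j) W < (1 / 2 : ℝ) ^ n :=
      hd.eventually (Iio_mem_nhds (pow_pos (by norm_num) n))
    refine squeeze_zero' (Eventually.of_forall fun j => cylDist_nonneg n _ _) ?_ hd
    filter_upwards [hev] with j hj
    have ht := term_le_galleryDist n (Ws j) W
    rcases le_or_gt ((1 / 2 : ℝ) ^ n) (cylDist n (Ws j) W) with h | h
    · rw [min_eq_left h] at ht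
      exact absurd (ht.trans_lt hj) (lt_irrefl _)
    · rw [min_eq_right h.le] at ht
      exact ht
  have h3 : Tendsto (fun j => eLpNorm (Function.uncurry (Ws j) - Function.uncurry W) 3
      (volume.restrict (parabolicCylinder ((n : ℝ) + 1) (0 : ℝ × (EuclideanSpace ℝ (Fin 3))))))
      atTop (𝓝 0) := by
    refine (ENNReal.tendsto_toReal_iff (fi := atTop) hfin ENNReal.zero_ne_top).1 ?_
    rw [ENNReal.toReal_zero]
    exact hcyl
  exact tendsto_of_tendsto_of_tendsto_of_le_of_le tendsto_const_nhds h3 (fun _ => zero_le)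
    fun j => eLpNorm_mono_measure _ (Measure.restrict_mono hsub le_rfl)

end GalleryDist

end Summit.NavierStokesRegularity.NavierStokesRegularity.Cruxes.ScarEnvelopeTypeI.ZoomDictionary
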